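import Literature.MathematicalPhysics.QuantumFieldTheory.Balaban1983to89.B7ConclKExp
import Literature.MathematicalPhysics.QuantumFieldTheory.Balaban1983to89.B9Ineq3137LocalSup

/-!
# `Balaban1983to89.B7Prop3to7Local` — T. Bałaban, *Averaging operations for lattice gauge theories*, Commun. Math. Phys. **98**
(1985) 17–51 [Balaban1985Averaging]: **Propositions 3–7 (Sects. C–D, pp. 27–43) AS TYPED (`B7.Prop3Printed` … `B7.Prop7Printed`) WITH
THE PRINTED LOCALITY** — the small-field hypotheses (44) «`|V₀(∂p) − 1| < α₀`» ∕ (52) «`|U₀(∂p) − 1| < α₀η²`» are assumed ONLY for the unit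
plaquettes `p ⊂ B(c₋) ∪ B(c₊)` (one step) ∕ `p ⊂ Bᵏ(c₋) ∪ Bᵏ(c₊)` (the two `k`-blocks at the ends of the bond `c` of `Ω^{(k)}` at which
(121)–(123) ∕ (127)/(134)/(135)/(156)/(157)/(164) are read), and `U₀` is asked to be `G`-valued only on the bonds of that box — kernel-checked for
the concrete `ℤᵈ` objects of the lineage, with the constants of the global theorems `B7ConclOneStep.prop3Printed_BD`, `B7ConclKExp.prop4Printed_K`
… `prop7Printed_K` (Props. 1–2 with the printed locality are b07's `B7Prop1Local.prop1Printed_concrete_local` ∕ `prop2Printed_concrete_local`).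

statement-level skeleton of published theorems with citation tags; proofs where landed; nothing here is a claim about the Yang–Mills mass gap

CITATION HEADER (lean-in-tree rule).  Cell `pub-ymgap`, seat `pub-ymgap-dag-n04-a` (Track-A DAG node N04 = [B7], KNIT-BY-NAME; generation
g2, 2026-08-25), a B7 SUPPLEMENT to the lit-balaban r04 lineage (`B7ConclKExp`, the global family `concreteKExp`) by the DEVICE of the b07
lineage (`B7Prop1Local` §3: the clamped extension `clampCfg` — «a local hypothesis (44)/(52) on the box becomes a global one»; there used for
Props. 1–2) and the LOCALITY theorems of the r20 / n16 lineages (`B7LocalityGeneral.logCovIter_congr`, `B9Ineq3137LocalSup.linCovIter_congr`,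
`CCovIter_congr`; `B7Prop5GeneralLevels.Qcov_congr`, `Ccov_congr`; `B7Prop1Local.avgIter_congr`).  It answers the standing located item (g1)
«ℤᵈ-GLOBAL hypotheses ∕ RESTRICT» of the N04 species reading of record (pub-ymgap INBOX [REFA-G2-N04-SPECIES], R431 (g1); dag-n04-a g0
[DAGN04A-G0-G1-HANDLES] + ERRATUM: «Props. 3–10 remain typed with ℤᵈ-global small-field hypotheses … that, precisely, is the residual RESTRICT note»)
for Proposition 3 and the four `k`-fold propositions; with b07's `B7Prop1Local.concreteKStepLocal` (Prop. 2) this leaves, of the five carrier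
families of the leaf `B7.Concl`, only the gauge-transformation carriers of Props. 8–10 (`B7ConclGauge`) under the global hypothesis.

PRINT (verbatim; journal page = PDF page + 16).  Prop. 3 p. 36: «There exist constants `C₁, c₃`, `c₃ ≦ c₂`, such that for `α₀, α₁ ≦ c₃` the
function `Q(V₀, A) = (1/i) log V̄₁` is an analytic function of `A` satisfying the equalities and bounds (122)–(124). The constant `C₁` depends on
`d` and `c₃` depends on `d` and `L`.»; p. 34: «`(V̿₁)_c` is an analytic function of the variables `A_b`, `b ⊂ B(c₋) ∪ B(c₊)`».  p. 24 (after (43)): «Let us notice that this definition is local in the sense that `Ū^k_c`,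
`c ⊂ Ω^{(k)}`, depends only on the bond variables `U_b` for `b ⊂ B^k(c₋) ∪ B^k(c₊)`. This property will play a very important role in the
future.»  p. 26, (52): «`|U(∂p) − 1| < α₀η²`, `η = L^{−k}` (52) on some set of plaquettes.»  p. 31 (after (91)): the operations (89)–(91) «have
the same locality properties».  Prop. 4 pp. 38–39: «There exist constants `C₂, c₄` such that for `α₀, α₁ ≦ c₄` the function `Q_k(U₀, ηA, c) =
(1/i) log(Ū₁ᵏ)_c`, `c ⊂ Ω^{(k)}`, is an analytic function of the variables `A_b`, `b ⊂ Bᵏ(c₋) ∪ Bᵏ(c₊)`. Further we have `Q_k(U₀, ηA) =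
Q_k(U₀)A + C_k(U₀, A)`, (134) and `|C_k(U₀, A)| ≦ C₂|A|² < C₂α₁²`. (135) …»  Prop. 5 p. 42: «… `|(δ/δA_b)Q_k(U₀, ηA, c)| ≦ 1 + 2C′₁α₀ + C₃|A| <
1 + 2C′₁α₀ + C₃α₁`, (156) `|(δ/δA_b)C_k(U₀, A, c)| ≦ C₃|A| < C₃α₁`. (157)»  Prop. 6 p. 43: «If `U₀` satisfies (52), then `\overline{U′U₀}ᵏ` is an
analytic function of `A′` … Moreover, we have a bound `|\overline{U′U₀}ᵏ(Ū₀ᵏ)⁻¹ − 1| < O(1)α₁`. (164) …»  Prop. 7 p. 43: «For `U₀` satisfying (52)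
and `U′ = e^{iηA′}`, `|A′| < α₁`, `α₀, α₁` sufficiently small, the function `Q_k(U′U₀, ηA)` is analytic in complex variables `A′, A`, and
Proposition 4 holds uniformly in `A′`.»

DICTIONARY (print ↦ Lean; conventions of `B7Prop1Local` / `B7ConclOneStep` / `B7ConclKExp`).  `B(c₋) ∪ B(c₊)` for the `L`-bond `c = ⟨q, q + Le_κ⟩`
↦ the box `[q, bondHi L q κ] = [q, q + (L−1)𝟙 + Le_κ]`; «(44) on `B(c₋) ∪ B(c₊)`» ↦ `pdevOn q (bondHi L q κ) V₀ < α₀`;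
`Bᵏ(c₋) ∪ Bᵏ(c₊)` for the bond `c = ⟨z, z + e_κ⟩` of `Ω^{(k)}`
↦ the coordinate box `[loK L k z, bondHiK L k z κ] = [Lᵏz, Lᵏz + (Lᵏ − 1)𝟙 + Lᵏe_κ]` of the unit lattice; «(52) for `p ⊂ Bᵏ(c₋) ∪ Bᵏ(c₊)`» ↦
`pdevOn (loK L k z) (bondHiK L k z κ) U₀ · η⁻² < α₀` (`B7Prop1Local.pdevOn`: the supremum over the plaquettes with all four corners in the box);
«`U₀` a `G`-valued configuration on `Bᵏ(c₋) ∪ Bᵏ(c₊)`» ↦ the guard `grpDefectOn G lo hi U₀` (`0` iff every bond variable with both endpoints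
in the box lies in `G`, else `1`; cf. the global guard `B7ConclKExp.grpDefect`).

WHAT THIS FILE PROVES (kernel, no `sorry`, standard axioms).
* §1 box bookkeeping: `grpDefectOn` (+ `_of_mem`, `_of_not_mem`, `_nonneg`, `_le_one`, `_le_grpDefect`), `clampCfg_mem_of_box` (the clamped extension of a
  configuration `G`-valued on the box's bonds is `G`-valued everywhere), `hol_plaqWord_mem_of_box`, `pdevOn_bddAbove_of_box`,
  `pdevOn_le_pdev`, `pdev_clampCfg_le_of_box` (its global plaquette deviation is at most the deviation INSIDE the box — `B7Prop1Local.pdev_clampCfg_le` with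
  the `U1`-valuedness asked on the box only), `regimeOn_of_dev_lt` (decoding the guarded local hypothesis), **`clamped_regime`** (the local
  hypothesis for `U₀` ⟹ the GLOBAL hypothesis of `concreteKExp` for the clamped extension `π^*U₀`, which agrees with `U₀` on the box).
* §2 the LOCAL `k`-fold carrier `concreteKExpLocal 𝔸 G L : KIdx d → B7.KExp` — `B7ConclKExp.concreteKExp` with `plaqDevEta` localised to
  `Bᵏ(c₋) ∪ Bᵏ(c₊)` and (164) read AT the bond `c` of the index (see READINGS); the other eight fields verbatim (`concreteKExpLocal_fields`, `rfl`);
  `plaqDevEta_local_le_global`: the local hypothesis functional is dominated by the global one on `{|u| ≤ 1, |u⁻¹| ≤ 1}`-valued configurations.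
* §3 **`prop4Printed_K_local`, `prop5Printed_K_local`, `prop6Printed_K_local`, `prop7Printed_K_local`, `p4567_K_local`** — `B7.Prop4Printed` …
  `B7.Prop7Printed` for `concreteKExpLocal 𝔸 G L`, every `d`, `L ≥ 2`, `G` any `AvgClosed` gauge group, `𝔸` any complete normed `ℂ`-algebra
  with `‖1‖ = 1`; constants: those of the global theorems (Props. 4, 5, 7: the SAME witnesses `C₂`, `C′₁`, `C₃`, transported through the
  existential, thresholds `min{c, 1}` = `c` in effect since the lineage's `c = cK d L ≤ ½`; Prop. 6: `O(1) = 200(d+1)`, `c = cK d L` explicitly);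
  §4 the LOCAL one-step carrier `concreteOneStepLocalC 𝔸 L : Site d × Fin d → B7.OneStep` ((44) on `B(c₋) ∪ B(c₊)` only; Prop-3 fields genuine,
  Prop-1 field trivial) with **`prop3Printed_localC`** (every `d`, `L ≥ 1`, `c₂ > 0`; witnesses those of `B7ConclOneStep.prop3Printed_BD`:
  `C₁ = 131072(d+1)²`, `c₃ = min{c₂, 1/(1024(d+1)(d+4)L²), 1/(128(d+1)L)}`, re-derived from the kernels `B7Eq123General.blockLoops_of_pdev` ∕
  `norm_Ccov_le_of_pdev`, `B7Prop3GeneralAnalytic.prop3_general_analyticAt_of_le_c3` at the clamped extension);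
  §5 subgroups (`grpDefectOn_anti`, `kExpLocal_plaqDevEta_anti`, `p4567_K_local_of_le`: the typed statements transfer to any `G ≤ G′`, constants
  unchanged — the twin of `B7ConclSubgroup` for the local family); §6 the paper's settings with the operator norm: `p4567_unitaryGroup_local`
  (`G = U(N)`) and `p4567_specialUnitary_local` (`G = SU(N)`, EVERY `N ≥ 1`).
METHOD.  Given `U₀` small and `G`-valued on the box, the clamped extension `π^*U₀` (`B7Prop1Local.clampCfg`) is `G`-valued on `ℤᵈ`, satisfies
(52) everywhere with the same `α₀` (each of its plaquette variables is `1` or a plaquette variable of `U₀` inside the box,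
`B7Prop1Local.hol_plaqWord_clampCfg`) and agrees with `U₀` on the box; the global theorem applies to `π^*U₀`; and every conclusion functional
at `c` — `Q_k(U₀, ηA)(c)` (127) as a function of finitely many bond variables, `C_k(U₀, A)(c)` (134), the single-bond derivatives (156)/(157),
`Q_k(U′U₀, ηA)(c)` and `C_k(U′U₀, A)(c)` (Prop. 7), `\overline{U′U₀}ᵏ(c)(Ū₀ᵏ(c))⁻¹` (164) — takes the same value at `U₀` and at `π^*U₀`
(`logCovIter_congr`, `linCovIter_congr`, `CCovIter_congr`, `avgIter_congr`, products preserving agreement `B7LocalityGeneral.agreeOn_mul`).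
Prop. 6 is re-derived from the pointwise kernel `B7Prop6GeneralLevels.eq164_general_unconditional` (the global leaf's (164) is a supremum over
all bonds of `Ω^{(k)}`, which a local hypothesis cannot feed).  No gauge fixing, no new estimate.

READINGS / DIVERGENCES (located).  (a) (164) is read AT THE BOND `c` OF THE INDEX (`avgRatioDev U₀ A′ = ‖\overline{U′U₀}ᵏ(c)(Ū₀ᵏ(c))⁻¹ − 1‖`),
print's «`|\overline{U′U₀}ᵏ(Ū₀ᵏ)⁻¹ − 1| < O(1)α₁`» bond by bond — the global family `concreteKExp` types the supremum over all bonds, which is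
the same statement under the global (52) and has no local analogue; every other field is `concreteKExp`'s verbatim (inherited readings: `≤`/`<`
as typed in `B7.lean`; Banach carrier `𝔸`, `U1 ⊇ G`; (134)/(135) in the units `Lᵏη = 1`; analyticity over every finite set of bond variables;
the guard).  (b) HYPOTHESIS REGION = the box `Bᵏ(c₋) ∪ Bᵏ(c₊)` read as its set of SITES (a plaquette is «in» the box iff its four corners are;
`B7Prop1Local` DIVERGENCE (a)): the fewest plaquettes, so the statements here imply the printed ones under any reading of «(52) on `Ω`»,
`Ω ⊇ Bᵏ(c₋) ∪ Bᵏ(c₊)`, and imply the global family's pointwise content.  (c) AMBIENT LATTICE `ℤᵈ` (total functions on bonds): since hypothesis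
AND conclusion now involve only the bonds of a finite box, a configuration given on any region `⊇ Bᵏ(c₋) ∪ Bᵏ(c₊)` is covered by extending it
arbitrarily (e.g. by `clampCfg` itself); the torus bookkeeping is `B7AvgPeriodicity`'s.  (d) The one-step family keeps `B7ConclOneStep`'s readings (`Cfg` =
`{|u| ≤ 1, |u⁻¹| ≤ 1}`-valued on all of `ℤᵈ` — immaterial, cf. (c): extend by `1`); its Prop-1 field is trivial (Prop. 1 local is b07's
`B7Prop1Local.concreteOneStepLocal`, whose Prop-3 fields are trivial — a local twin of `B7.Concl`'s single one-step family is not attempted).  NOT CLAIMED: Props. 8–10 (Sects. E–F; `B7ConclGauge`) with local hypotheses — not in this file (Prop. 10 region-local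
for [B8]'s consumers is `B8Eq178Local.prop10_local`); a local `B7.Concl` record; nothing about other carriers; nothing of the series' end-statement.
DECLARATIONS: `grpDefectOn`, the families `concreteKExpLocal`, `concreteOneStepLocalC`, theorems.  Finite lattice geometry at fixed `η`; NOT
continuum ∕ OS ∕ mass gap.

[cite: Balaban1985Averaging, Proposition 3 (121)–(123) p.36, Proposition 4 (134)–(135) pp.38–39, Proposition 5 (156)–(157) p.42, Proposition 6 (164) p.43, Proposition 7 p.43, (44) p.24, (52) p.26, p.24 (sentence after (43)), p.31 (sentence after (91)), (127) p.37]
-/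

noncomputable section

open scoped BigOperators
open NormedSpace

namespace Literature.MathematicalPhysics.QuantumFieldTheory.Balaban1983to89.B7Prop3to7Local

open B7Prop1Explicit B7Prop2Explicit B7Prop3Flat B7Prop4GeneralLevels B7Prop5Flat B7Prop5GeneralInduction B7Prop5GeneralLevels
  B7ConclOneStep B7ConclKExp
open B7Prop1Local (InBox AgreeOn PlaqIn loK bondHiK clamp clampCfg clampCfg_agree clamp_inBox clamp_add_e_of
  hol_plaqWord_clampCfg pdevOn pdevOn_nonneg add_e_apply avgIter_congr hol_plaqWord_eq inBox_of_between)
open B7LocalityGeneral (logCovIter_congr agreeOn_mul)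
open B9Ineq3137LocalSup (linCovIter_congr CCovIter_congr)
open B7Prop3GeneralLinear (Qcov Ccov)
open B7Eq123General (blockLoops_of_pdev norm_Ccov_le_of_pdev)
open B7Prop3GeneralAnalytic (prop3_general_analyticAt_of_le_c3)

-- `Site` alone would resolve to the torus sites of `Setup.lean`; re-export the `ℤ^d` sites of `B7Prop1Explicit`.
export B7Prop1Explicit (Site)

variable {d : ℕ}

/-! ## §1 Box bookkeeping: the box-local guard, the clamped extension from box data, decoding the local hypothesis -/

section Box

variable {G : Type*} [Group G] {lo hi : Site d}

open Classical in
/-- `0` for a configuration whose bond variables with both endpoints in the box `[lo, hi]` lie in `G`, `1` otherwise: (52) is a condition on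
`G`-valued lattice gauge fields (p. 18 «`U(N)`», p. 23) ON THE REGION where it is assumed — the box-local twin of the global guard
`B7ConclKExp.grpDefect` (plumbing). [cite: Balaban1985Averaging, (52) p.26, p.23] -/
def grpDefectOn (S : Subgroup G) (lo hi : Site d) (U : Site d → Fin d → G) : ℝ :=
  if (∀ (x : Site d) (κ : Fin d), InBox lo hi x → InBox lo hi (x + e κ) → U x κ ∈ S) then 0 else 1

/-- `grpDefectOn = 0` on configurations `G`-valued on the box's bonds. [cite: Balaban1985Averaging, (52) p.26] -/
theorem grpDefectOn_of_mem {S : Subgroup G} {U : Site d → Fin d → G}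
    (h : ∀ (x : Site d) (κ : Fin d), InBox lo hi x → InBox lo hi (x + e κ) → U x κ ∈ S) :
    grpDefectOn S lo hi U = 0 := by
  unfold grpDefectOn; rw [if_pos h]

/-- `grpDefectOn = 1` otherwise. [cite: Balaban1985Averaging, (52) p.26] -/
theorem grpDefectOn_of_not_mem {S : Subgroup G} {U : Site d → Fin d → G}
    (h : ¬ ∀ (x : Site d) (κ : Fin d), InBox lo hi x → InBox lo hi (x + e κ) → U x κ ∈ S) :
    grpDefectOn S lo hi U = 1 := by
  unfold grpDefectOn; rw [if_neg h]

/-- `0 ≤ grpDefectOn`. [cite: Balaban1985Averaging, (52) p.26] -/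
theorem grpDefectOn_nonneg (S : Subgroup G) (lo hi : Site d) (U : Site d → Fin d → G) : 0 ≤ grpDefectOn S lo hi U := by
  unfold grpDefectOn; split_ifs <;> norm_num

/-- `grpDefectOn ≤ 1`. [cite: Balaban1985Averaging, (52) p.26] -/
theorem grpDefectOn_le_one (S : Subgroup G) (lo hi : Site d) (U : Site d → Fin d → G) : grpDefectOn S lo hi U ≤ 1 := by
  unfold grpDefectOn; split_ifs <;> norm_num

/-- The box-local guard is dominated by the global guard `B7ConclKExp.grpDefect` (a configuration `G`-valued everywhere is `G`-valued on
the box). [cite: Balaban1985Averaging, (52) p.26] -/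
theorem grpDefectOn_le_grpDefect {𝔹 : Type*} [Monoid 𝔹] (S : Subgroup 𝔹ˣ) (lo hi : Site d) (U : Site d → Fin d → 𝔹ˣ) :
    grpDefectOn S lo hi U ≤ grpDefect S U := by
  by_cases h : ∀ (x : Site d) (κ : Fin d), U x κ ∈ S
  · rw [grpDefectOn_of_mem (fun x κ _ _ => h x κ), grpDefect_of_mem h]
  · rw [grpDefect_of_not_mem h]
    exact grpDefectOn_le_one S lo hi U

/-- The clamped extension `π^*U` (`B7Prop1Local.clampCfg`) of a configuration `G`-valued ON THE BONDS OF THE BOX is `G`-valued on all of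
`ℤᵈ`: its bond variables are `1` or bond variables `U(π(x), π(x) + e_κ)` of genuine bonds of the box (cf. `B7Prop1Local.clampCfg_mem`, which
asks `G`-valuedness everywhere). [cite: Balaban1985Averaging, p.24 (sentence after (43)), (52) p.26] -/
theorem clampCfg_mem_of_box (hlohi : ∀ i, lo i ≤ hi i) {S : Subgroup G} {U : Site d → Fin d → G}
    (hU : ∀ (x : Site d) (κ : Fin d), InBox lo hi x → InBox lo hi (x + e κ) → U x κ ∈ S) (x : Site d) (κ : Fin d) :
    clampCfg lo hi U x κ ∈ S := by
  unfold clampCfg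
  split_ifs with h
  · refine hU _ _ (clamp_inBox hlohi x) ?_
    rw [← clamp_add_e_of h]
    exact clamp_inBox hlohi _
  · exact S.one_mem

/-- The plaquette variable `U(∂p)` of a plaquette `p` INSIDE the box is a product of bond variables of the box, hence lies in any subgroup
containing them. [cite: Balaban1985Averaging, (9) p.18, p.24] -/
theorem hol_plaqWord_mem_of_box {S : Subgroup G} {U : Site d → Fin d → G}
    (hU : ∀ (x : Site d) (κ : Fin d), InBox lo hi x → InBox lo hi (x + e κ) → U x κ ∈ S)
    {p : Site d × Fin d × Fin d} (hp : PlaqIn lo hi p) : hol U p.1 (plaqWord p.2.1 p.2.2) ∈ S := by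
  obtain ⟨x, μ, ν⟩ := p
  obtain ⟨hx, hx'⟩ := hp
  dsimp only at hx hx' ⊢
  have hμ : InBox lo hi (x + e μ) := inBox_of_between hx hx' fun i => by
    rw [add_e_apply, add_e_apply, add_e_apply]; split_ifs <;> omega
  have hν : InBox lo hi (x + e ν) := inBox_of_between hx hx' fun i => by
    rw [add_e_apply, add_e_apply, add_e_apply]; split_ifs <;> omega
  have hνμ : InBox lo hi (x + e ν + e μ) := by rw [add_right_comm]; exact hx'
  rw [hol_plaqWord_eq]
  exact S.mul_mem (S.mul_mem (S.mul_mem (hU x μ hx hμ) (hU _ ν hμ hx')) (S.inv_mem (hU _ μ hν hνμ)))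
    (S.inv_mem (hU x ν hx hν))

variable {𝔸 : Type*} [NormedRing 𝔸] [NormOneClass 𝔸]

/-- `sup_{p ⊂ [lo, hi]} |U(∂p) − 1|` is a genuine supremum (every term `≤ 2`) as soon as `U` is `{|u| ≤ 1, |u⁻¹| ≤ 1}`-valued on the box's
bonds (cf. `B7Prop1Local.pdevOn_bddAbove`: valuedness everywhere). [cite: Balaban1985Averaging, (52) p.26, p.24] -/
theorem pdevOn_bddAbove_of_box {U : Site d → Fin d → 𝔸ˣ}
    (hU : ∀ (x : Site d) (κ : Fin d), InBox lo hi x → InBox lo hi (x + e κ) → U x κ ∈ U1 𝔸) :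
    BddAbove (Set.range fun p : {p : Site d × Fin d × Fin d // PlaqIn lo hi p} =>
      ‖((hol U p.1.1 (plaqWord p.1.2.1 p.1.2.2) : 𝔸ˣ) : 𝔸) - 1‖) := by
  refine ⟨2, ?_⟩
  rintro _ ⟨p, rfl⟩
  refine (norm_sub_le _ _).trans ?_
  rw [norm_one]
  have := (hol_plaqWord_mem_of_box hU p.2).1
  linarith

/-- On a `{|u| ≤ 1, |u⁻¹| ≤ 1}`-valued configuration the deviation INSIDE the box is at most the global deviation `B7Prop2Explicit.pdev`
(a supremum over more plaquettes; both genuine suprema). [cite: Balaban1985Averaging, (52) p.26, (44) p.24] -/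
theorem pdevOn_le_pdev {U : Site d → Fin d → 𝔸ˣ} (hU : ∀ (x : Site d) (κ : Fin d), U x κ ∈ U1 𝔸) :
    pdevOn lo hi U ≤ pdev U :=
  Real.iSup_le (fun p => le_pdev hU p.1.1 p.1.2.1 p.1.2.2) (pdev_nonneg U)

/-- The global plaquette deviation of the clamped extension `π^*U` is at most the deviation of `U` INSIDE the box — `B7Prop1Local.pdev_clampCfg_le`
with the `{|u| ≤ 1, |u⁻¹| ≤ 1}`-valuedness asked on the box's bonds only. [cite: Balaban1985Averaging, (52) p.26, p.24 (sentence after (43))] -/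
theorem pdev_clampCfg_le_of_box (hlohi : ∀ i, lo i ≤ hi i) {U : Site d → Fin d → 𝔸ˣ}
    (hU : ∀ (x : Site d) (κ : Fin d), InBox lo hi x → InBox lo hi (x + e κ) → U x κ ∈ U1 𝔸) :
    pdev (clampCfg lo hi U) ≤ pdevOn lo hi U := by
  refine Real.iSup_le (fun p => ?_) (pdevOn_nonneg lo hi U)
  obtain ⟨x, κ, ν⟩ := p
  rcases eq_or_ne κ ν with rfl | hκν
  · simp only [hol_plaqWord_self, Units.val_one, sub_self, norm_zero]; exact pdevOn_nonneg lo hi U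
  rcases hol_plaqWord_clampCfg hlohi U x hκν with h | ⟨h1, h2⟩
  · simp only [h, Units.val_one, sub_self, norm_zero]; exact pdevOn_nonneg lo hi U
  · simp only [h2]
    exact le_ciSup (pdevOn_bddAbove_of_box hU) ⟨_, h1⟩

omit [NormOneClass 𝔸] in
/-- **Decoding the guarded LOCAL hypothesis**: `η⁻²·pdevOn lo hi U + grpDefectOn G lo hi U < α₀ ≤ 1` iff-direction used — `U` is `G`-valued
on the box's bonds and `sup_{p ⊂ box} ‖U(∂p) − 1‖ < α₀η²` (the box-local twin of `B7ConclKExp.regime_of_dev_lt`). [cite: Balaban1985Averaging, (52) p.26] -/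
theorem regimeOn_of_dev_lt {G : Subgroup 𝔸ˣ} {U : Site d → Fin d → 𝔸ˣ} {L k : ℕ} (hL : 1 ≤ L) {α₀ : ℝ}
    (h : pdevOn lo hi U * ((L : ℝ) ^ k) ^ 2 + grpDefectOn G lo hi U < α₀) (hα : α₀ ≤ 1) :
    (∀ (x : Site d) (κ : Fin d), InBox lo hi x → InBox lo hi (x + e κ) → U x κ ∈ G) ∧
      pdevOn lo hi U < α₀ * (((L : ℝ) ^ k)⁻¹) ^ 2 := by
  have hL0 : (0 : ℝ) < L := by exact_mod_cast hL
  have hp : 0 ≤ pdevOn lo hi U * ((L : ℝ) ^ k) ^ 2 := mul_nonneg (pdevOn_nonneg lo hi U) (by positivity)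
  have hG : ∀ (x : Site d) (κ : Fin d), InBox lo hi x → InBox lo hi (x + e κ) → U x κ ∈ G := by
    by_contra hn
    rw [grpDefectOn_of_not_mem hn] at h
    linarith
  refine ⟨hG, ?_⟩
  rw [grpDefectOn_of_mem hG, add_zero] at h
  have hLk : (0 : ℝ) < ((L : ℝ) ^ k) ^ 2 := by positivity
  rw [inv_pow, ← div_eq_mul_inv, lt_div_iff₀ hLk]
  exact h

/-- **THE CLAMPED WITNESS for the box `Bᵏ(c₋) ∪ Bᵏ(c₊)`** of the bond `c = ⟨z, z + e_κ⟩` of `Ω^{(k)}`: if `U₀` satisfies the guarded LOCAL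
hypothesis `η⁻²·pdevOn + grpDefectOn G < α₀ ≤ 1` on that box, then its clamped extension `π^*U₀` is `G`-valued on `ℤᵈ`, satisfies the guarded
GLOBAL hypothesis `η⁻²·pdev + grpDefect G < α₀` of `B7ConclKExp.concreteKExp`, and agrees with `U₀` on the bonds of the box.  (Device of
`B7Prop1Local` §3, not in print.) [cite: Balaban1985Averaging, (52) p.26, p.24 (sentence after (43))] -/
theorem clamped_regime {G : Subgroup 𝔸ˣ} (hGU : G ≤ U1 𝔸) {L : ℕ} (hL : 1 ≤ L) (k : ℕ) (z : Site d) (κ : Fin d)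
    {U₀ : Site d → Fin d → 𝔸ˣ} {α₀ : ℝ}
    (hdev : pdevOn (loK L k z) (bondHiK L k z κ) U₀ * ((L : ℝ) ^ k) ^ 2
      + grpDefectOn G (loK L k z) (bondHiK L k z κ) U₀ < α₀) (hα : α₀ ≤ 1) :
    (∀ (x : Site d) (ν : Fin d), clampCfg (loK L k z) (bondHiK L k z κ) U₀ x ν ∈ G) ∧
      pdev (clampCfg (loK L k z) (bondHiK L k z κ) U₀) * ((L : ℝ) ^ k) ^ 2
        + grpDefect G (clampCfg (loK L k z) (bondHiK L k z κ) U₀) < α₀ ∧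
      AgreeOn (loK L k z) (bondHiK L k z κ) U₀ (clampCfg (loK L k z) (bondHiK L k z κ) U₀) := by
  have hP : (1 : ℤ) ≤ (L : ℤ) ^ k := one_le_pow₀ (by exact_mod_cast hL)
  have hlohi : ∀ i, loK L k z i ≤ bondHiK L k z κ i := fun i => by
    simp only [loK, bondHiK]; split_ifs <;> linarith
  obtain ⟨hUG, -⟩ := regimeOn_of_dev_lt hL hdev hα
  have hmem : ∀ (x : Site d) (ν : Fin d), clampCfg (loK L k z) (bondHiK L k z κ) U₀ x ν ∈ G :=
    clampCfg_mem_of_box hlohi hUG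
  refine ⟨hmem, ?_, (clampCfg_agree U₀).symm⟩
  rw [grpDefect_of_mem hmem, add_zero]
  have hle := pdev_clampCfg_le_of_box hlohi (fun x ν hx hxe => hGU (hUG x ν hx hxe))
  have h0 := grpDefectOn_nonneg G (loK L k z) (bondHiK L k z κ) U₀
  have hLk : (0 : ℝ) ≤ ((L : ℝ) ^ k) ^ 2 := by positivity
  have hle' := mul_le_mul_of_nonneg_right hle hLk
  linarith

end Box

/-! ## §2 The local `k`-fold carrier -/

section Carrier

variable (𝔸 : Type) [NormedRing 𝔸] [NormOneClass 𝔸] [NormedAlgebra ℂ 𝔸] [CompleteSpace 𝔸] (G : Subgroup 𝔸ˣ)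

/-- **The concrete `k`-fold family of B7 Sect. D on `ℤᵈ` WITH THE PRINTED LOCALITY** (index `i = (k; c; b)` as for `B7ConclKExp.concreteKExp`:
the order `k`, the bond `c = ⟨z, z + e_κ⟩` of `Ω^{(k)}` at which (127)/(134)/(135)/(164) are read, the fine bond `b = ⟨y, y + e_μ⟩` of the
`δ/δA_b` in (156)/(157)): `Cfg` = all configurations `ℤᵈ → (Fin d → 𝔸ˣ)`; `plaqDevEta U = η⁻²·sup_{p ⊂ Bᵏ(c₋) ∪ Bᵏ(c₊)}‖U(∂p) − 1‖ +
grpDefectOn G` — hypothesis (52) and `G`-valuedness ON THE TWO `k`-BLOCKS AT THE ENDS OF `c` ONLY; `avgRatioDev U₀ A′ =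
‖\overline{U′U₀}ᵏ(c)(Ū₀ᵏ(c))⁻¹ − 1‖` — (164) AT `c`; the remaining fields (`Fld`, `k`, `fldNorm`, `IsAnalyticQk`, `remCk`, `dQk`, `dCk`, `pert`,
`IsJointlyAnalytic`) are `concreteKExp`'s verbatim (`concreteKExpLocal_fields`). [cite: Balaban1985Averaging, (52) p.26, p.24 (sentence after (43)), (127) p.37, (134) p.38, (137)–(138) p.39, (156)–(158) p.42, (164) p.43, Proposition 7 p.43] -/
def concreteKExpLocal (L : ℕ) (i : KIdx d) : B7.KExp where
  Cfg := Site d → Fin d → 𝔸ˣ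
  Fld := BddFld d 𝔸
  k := i.k
  plaqDevEta U := pdevOn (loK L i.k i.z) (bondHiK L i.k i.z i.κ) U * ((L : ℝ) ^ i.k) ^ 2
    + grpDefectOn G (loK L i.k i.z) (bondHiK L i.k i.z i.κ) U
  fldNorm A := supNorm A
  IsAnalyticQk U₀ r := ∀ S : Finset (Site d × Fin d),
    AnalyticOnNhd ℂ (fun a : S → 𝔸 => logCovIter L U₀ (((L : ℝ) ^ i.k)⁻¹ • insCfg S a) i.k i.z i.κ) {a | ∀ s, ‖a s‖ < r}
  remCk U₀ A := ‖logCovIter L U₀ (((L : ℝ) ^ i.k)⁻¹ • A.1) i.k i.z i.κ - linCovIter L U₀ (((L : ℝ) ^ i.k)⁻¹ • A.1) i.k i.z i.κ‖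
  dQk U₀ A := ⨆ X : Metric.closedBall (0 : 𝔸) 1,
    ((((L : ℝ) ^ i.k)⁻¹) ^ d)⁻¹ * ‖lineDeriv ℂ (fun A' => logCovIter L U₀ (((L : ℝ) ^ i.k)⁻¹ • A') i.k i.z i.κ) A.1 (bump i.y i.μ X.1)‖
  dCk U₀ A := ⨆ X : Metric.closedBall (0 : 𝔸) 1,
    ((((L : ℝ) ^ i.k)⁻¹) ^ d)⁻¹ * ‖lineDeriv ℂ (fun A' => CCovIter L U₀ (((L : ℝ) ^ i.k)⁻¹ • A') i.k i.z i.κ) A.1 (bump i.y i.μ X.1)‖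
  pert U₀ A' := expCfg (((L : ℝ) ^ i.k)⁻¹ • A'.1) * U₀
  avgRatioDev U₀ A' :=
    ‖((avgIter L (expCfg (((L : ℝ) ^ i.k)⁻¹ • A'.1) * U₀) i.k i.z i.κ : 𝔸ˣ) : 𝔸) *
        (((avgIter L U₀ i.k i.z i.κ)⁻¹ : 𝔸ˣ) : 𝔸) - 1‖
  IsJointlyAnalytic U₀ r' r := ∀ S' S : Finset (Site d × Fin d),
    AnalyticOnNhd ℂ (fun p : (S' → 𝔸) × (S → 𝔸) =>
        logCovIter L (expCfg (((L : ℝ) ^ i.k)⁻¹ • insCfg S' p.1) * U₀) (((L : ℝ) ^ i.k)⁻¹ • insCfg S p.2) i.k i.z i.κ)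
      {p | (∀ s, ‖p.1 s‖ < r') ∧ ∀ s, ‖p.2 s‖ < r}

omit [NormOneClass 𝔸] in
/-- Bookkeeping (`rfl`): the local family differs from `B7ConclKExp.concreteKExp` ONLY in the hypothesis functional `plaqDevEta` and in the
pointwise reading of (164); configurations, fields, `k`, `|A|`, the analyticity clauses, `C_k`, the derivatives (156)/(157) and the perturbation
`U′U₀` are literally the same. [cite: Balaban1985Averaging, (127) p.37, (134) p.38, (156)–(158) p.42] -/
theorem concreteKExpLocal_fields (L : ℕ) (i : KIdx d) :
    (concreteKExpLocal 𝔸 G (d := d) L i).Cfg = (concreteKExp 𝔸 G (d := d) L i).Cfg ∧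
    (concreteKExpLocal 𝔸 G (d := d) L i).Fld = (concreteKExp 𝔸 G (d := d) L i).Fld ∧
    (concreteKExpLocal 𝔸 G (d := d) L i).k = (concreteKExp 𝔸 G (d := d) L i).k ∧
    (concreteKExpLocal 𝔸 G (d := d) L i).fldNorm = (concreteKExp 𝔸 G (d := d) L i).fldNorm ∧
    (concreteKExpLocal 𝔸 G (d := d) L i).IsAnalyticQk = (concreteKExp 𝔸 G (d := d) L i).IsAnalyticQk ∧
    (concreteKExpLocal 𝔸 G (d := d) L i).remCk = (concreteKExp 𝔸 G (d := d) L i).remCk ∧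
    (concreteKExpLocal 𝔸 G (d := d) L i).dQk = (concreteKExp 𝔸 G (d := d) L i).dQk ∧
    (concreteKExpLocal 𝔸 G (d := d) L i).dCk = (concreteKExp 𝔸 G (d := d) L i).dCk ∧
    (concreteKExpLocal 𝔸 G (d := d) L i).pert = (concreteKExp 𝔸 G (d := d) L i).pert ∧
    (concreteKExpLocal 𝔸 G (d := d) L i).IsJointlyAnalytic = (concreteKExp 𝔸 G (d := d) L i).IsJointlyAnalytic :=
  ⟨rfl, rfl, rfl, rfl, rfl, rfl, rfl, rfl, rfl, rfl⟩

variable {𝔸 G} in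
/-- **The local hypothesis is WEAKER than the global one**: on every `{|u| ≤ 1, |u⁻¹| ≤ 1}`-valued configuration (in particular every
`G`-valued one, `G` `AvgClosed`) `(concreteKExpLocal 𝔸 G L i).plaqDevEta U ≤ (concreteKExp 𝔸 G L i).plaqDevEta U` — so, on such
configurations and below the smaller of the two thresholds, each of `prop4Printed_K_local` … `prop7Printed_K_local` below yields the conclusion
of the corresponding global theorem of `B7ConclKExp` at the index bond (for (164): the bound at the bond `c`).
[cite: Balaban1985Averaging, (52) p.26, p.24 (sentence after (43))] -/
theorem plaqDevEta_local_le_global (L : ℕ) (i : KIdx d) {U : Site d → Fin d → 𝔸ˣ}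
    (hU : ∀ (x : Site d) (κ : Fin d), U x κ ∈ U1 𝔸) :
    (concreteKExpLocal 𝔸 G (d := d) L i).plaqDevEta U ≤ (concreteKExp 𝔸 G (d := d) L i).plaqDevEta U := by
  dsimp only [concreteKExpLocal, concreteKExp]
  exact add_le_add (mul_le_mul_of_nonneg_right (pdevOn_le_pdev hU) (by positivity)) (grpDefectOn_le_grpDefect _ _ _ _)

end Carrier

/-! ## §3 Propositions 4–7 for the local family -/

section Props

variable {𝔸 : Type} [NormedRing 𝔸] [NormOneClass 𝔸] [NormedAlgebra ℂ 𝔸] [CompleteSpace 𝔸] {G : Subgroup 𝔸ˣ}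

/-- **Proposition 4 (134)–(135) + its analyticity clause AS TYPED (`B7.Prop4Printed`) WITH THE PRINTED LOCALITY** — for `concreteKExpLocal 𝔸 G L`,
`L ≥ 2`, `G` any `AvgClosed` gauge group: (52) and `G`-valuedness are assumed on `Bᵏ(c₋) ∪ Bᵏ(c₊)` only.  Witnesses: the `C₂` of
`B7ConclKExp.prop4Printed_K` (`16C₁`, `C₁ = 131072(d+1)²`, k-uniform) and `min{c₄, 1}` with its `c₄` (`= cK d L`).  Proof: the global theorem
at the clamped extension `π^*U₀` (`clamped_regime`); `A ↦ Q_k(·, ηA)(c)` and `C_k(·, A)(c)` take the same values at `U₀` and `π^*U₀`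
(`logCovIter_congr`, `linCovIter_congr`). [cite: Balaban1985Averaging, Proposition 4 (134)–(135) pp.38–39, (127) p.37, p.24 (sentence after (43))] -/
theorem prop4Printed_K_local (L : ℕ) (hL : 2 ≤ L) (hG : AvgClosed d L G) :
    B7.Prop4Printed (concreteKExpLocal 𝔸 G (d := d) L) := by
  have hL1 : 1 ≤ L := le_trans (by norm_num) hL
  obtain ⟨C₂, c₄, hC₂, hc₄, h⟩ := prop4Printed_K (𝔸 := 𝔸) (d := d) (G := G) L hL hG
  refine ⟨C₂, min c₄ 1, hC₂, lt_min hc₄ one_pos, ?_⟩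
  rintro ⟨k, z, κ, y, μ⟩ α₀ α₁ hα₀ hα₀c hα₁ hα₁c U₀ hdev
  dsimp only [concreteKExpLocal] at U₀ hdev ⊢
  have hα1 : α₀ ≤ 1 := hα₀c.trans (min_le_right _ _)
  obtain ⟨hU₀'G, hdev', hag⟩ := clamped_regime hG.le_U1 hL1 k z κ hdev hα1
  set U₀' := clampCfg (loK L k z) (bondHiK L k z κ) U₀ with hU₀'def
  obtain ⟨hanal, hrem⟩ := h ⟨k, z, κ, y, μ⟩ α₀ α₁ hα₀ (hα₀c.trans (min_le_left _ _)) hα₁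
    (hα₁c.trans (min_le_left _ _)) U₀' hdev'
  dsimp only [concreteKExp] at hanal hrem
  refine ⟨fun S => ?_, fun A hA => ?_⟩
  · -- the analyticity clause: the same function of the bond variables
    have hfun : (fun a : S → 𝔸 => logCovIter L U₀ (((L : ℝ) ^ k)⁻¹ • insCfg S a) k z κ) =
        fun a : S → 𝔸 => logCovIter L U₀' (((L : ℝ) ^ k)⁻¹ • insCfg S a) k z κ :=
      funext fun a => logCovIter_congr L hL1 k z κ hag (fun _ _ _ _ => rfl)
    rw [hfun]
    exact hanal S
  · -- (135) at `c`
    rw [logCovIter_congr L hL1 k z κ hag (fun _ _ _ _ => rfl), linCovIter_congr L hL1 k z κ hag (fun _ _ _ _ => rfl)]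
    exact hrem A hA

/-- **Proposition 5 (156)–(157) AS TYPED (`B7.Prop5Printed`) WITH THE PRINTED LOCALITY** — for `concreteKExpLocal 𝔸 G L`, `L ≥ 2`, `G`
`AvgClosed`: witnesses the `C′₁ = 1600(d+1)(d+4)L^{d+1}`, `C₃ = C3Gen d L` of `B7ConclKExp.prop5Printed_K` and `min{c₅, 1}` with its `c₅`.
Proof: the global theorem at `π^*U₀`; the single-bond directional derivatives of `A ↦ Q_k(·, ηA)(c)` and `A ↦ C_k(·, A)(c)` are derivatives of
the same functions at `U₀` and at `π^*U₀` (`logCovIter_congr`, `CCovIter_congr`). [cite: Balaban1985Averaging, Proposition 5 (156)–(157) p.42, (137)–(138) p.39, p.24 (sentence after (43))] -/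
theorem prop5Printed_K_local (L : ℕ) (hL : 2 ≤ L) (hG : AvgClosed d L G) :
    B7.Prop5Printed (concreteKExpLocal 𝔸 G (d := d) L) := by
  have hL1 : 1 ≤ L := le_trans (by norm_num) hL
  obtain ⟨C₁', C₃, c₅, hC₁', hC₃, hc₅, h⟩ := prop5Printed_K (𝔸 := 𝔸) (d := d) (G := G) L hL hG
  refine ⟨C₁', C₃, min c₅ 1, hC₁', hC₃, lt_min hc₅ one_pos, ?_⟩
  rintro ⟨k, z, κ, y, μ⟩ α₀ α₁ hα₀ hα₀c hα₁ hα₁c U₀ hdev A hA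
  dsimp only [concreteKExpLocal] at U₀ hdev A hA ⊢
  have hα1 : α₀ ≤ 1 := hα₀c.trans (min_le_right _ _)
  obtain ⟨hU₀'G, hdev', hag⟩ := clamped_regime hG.le_U1 hL1 k z κ hdev hα1
  set U₀' := clampCfg (loK L k z) (bondHiK L k z κ) U₀ with hU₀'def
  have h' := h ⟨k, z, κ, y, μ⟩ α₀ α₁ hα₀ (hα₀c.trans (min_le_left _ _)) hα₁ (hα₁c.trans (min_le_left _ _))
    U₀' hdev' A hA
  dsimp only [concreteKExp] at h'
  have hfunQ : (fun A' : Site d → Fin d → 𝔸 => logCovIter L U₀ (((L : ℝ) ^ k)⁻¹ • A') k z κ) =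
      fun A' : Site d → Fin d → 𝔸 => logCovIter L U₀' (((L : ℝ) ^ k)⁻¹ • A') k z κ :=
    funext fun A' => logCovIter_congr L hL1 k z κ hag (fun _ _ _ _ => rfl)
  have hfunC : (fun A' : Site d → Fin d → 𝔸 => CCovIter L U₀ (((L : ℝ) ^ k)⁻¹ • A') k z κ) =
      fun A' : Site d → Fin d → 𝔸 => CCovIter L U₀' (((L : ℝ) ^ k)⁻¹ • A') k z κ :=
    funext fun A' => CCovIter_congr L hL1 k z κ hag (fun _ _ _ _ => rfl)
  rw [hfunQ, hfunC]
  exact h'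

/-- **Proposition 6 (164) AS TYPED (`B7.Prop6Printed`) WITH THE PRINTED LOCALITY, (164) read at `c`** — for `concreteKExpLocal 𝔸 G L`, `L ≥ 2`,
`G` `AvgClosed`: witnesses `O(1) = 200(d+1)`, `c = cK d L` (as `B7ConclKExp.prop6Printed_K`).  For `U₀` small and `G`-valued on `Bᵏ(c₋) ∪ Bᵏ(c₊)`
and `|A′| < α₁`: `‖\overline{U′U₀}ᵏ(c)(Ū₀ᵏ(c))⁻¹ − 1‖ ≤ 200(d+1)|A′| < 200(d+1)α₁` — the pointwise kernel
`B7Prop6GeneralLevels.eq164_general_unconditional` at the clamped extension `π^*U₀`, both averages at `c` being the same for `U₀` and `π^*U₀`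
(`B7Prop1Local.avgIter_congr`, `B7LocalityGeneral.agreeOn_mul`). [cite: Balaban1985Averaging, Proposition 6 (164) p.43, p.24 (sentence after (43))] -/
theorem prop6Printed_K_local (L : ℕ) (hL : 2 ≤ L) (hG : AvgClosed d L G) :
    B7.Prop6Printed (concreteKExpLocal 𝔸 G (d := d) L) := by
  have hL1 : 1 ≤ L := le_trans (by norm_num) hL
  refine ⟨200 * ((d : ℝ) + 1), cK d L, by positivity, cK_pos d hL1, ?_⟩
  rintro ⟨k, z, κ, y, μ⟩ α₀ α₁ hα₀ hα₀c hα₁ hα₁c U₀ hdev A' hA'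
  dsimp only [concreteKExpLocal] at U₀ hdev A' hA' ⊢
  obtain ⟨hC0, -, hα4, -, -, -, -, hα1⟩ := alpha_regime (d := d) hL1 hα₀ hα₀c
  obtain ⟨hU₀'G, hdev', hag⟩ := clamped_regime hG.le_U1 hL1 k z κ hdev hα1
  set U₀' := clampCfg (loK L k z) (bondHiK L k z κ) U₀ with hU₀'def
  obtain ⟨-, h52⟩ := regime_of_dev_lt hL1 hdev' hα1
  obtain ⟨hAa, ha0⟩ := supNorm_spec A'
  set a := supNorm A' with ha
  have hac : a ≤ cK d L := hA'.le.trans hα₁c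
  obtain ⟨hB, hsc⟩ := scaling_data L k hL1 A'.1 hAa
  obtain ⟨hs, -, -, -⟩ := exp_regime (d := d) hL1 hα₀ hα₀c ha0 hac ha0 hac
  obtain ⟨-, -, hc3, -⟩ := field_regime (d := d) hL1 hac
  rw [← hsc] at hs hc3
  have h := B7Prop6GeneralLevels.eq164_general_unconditional L hL hG k U₀' hU₀'G hα₀ hC0 hα4 h52
    (((L : ℝ) ^ k)⁻¹ • A'.1) (by positivity) hB hs hc3 z κ
  rw [hsc] at h
  have hagp : AgreeOn (loK L k z) (bondHiK L k z κ) (expCfg (((L : ℝ) ^ k)⁻¹ • A'.1) * U₀)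
      (expCfg (((L : ℝ) ^ k)⁻¹ • A'.1) * U₀') := agreeOn_mul (fun _ _ _ _ => rfl) hag
  rw [avgIter_congr L hL1 k z κ hagp, avgIter_congr L hL1 k z κ hag]
  refine lt_of_le_of_lt h ?_
  have hd : (0 : ℝ) < 200 * ((d : ℝ) + 1) := by positivity
  exact mul_lt_mul_of_pos_left hA' hd

/-- **Proposition 7 AS TYPED (`B7.Prop7Printed`) WITH THE PRINTED LOCALITY** — for `concreteKExpLocal 𝔸 G L`, `L ≥ 2`, `G` `AvgClosed`:
witnesses the `C₂ = 16C₁′`, `C₁′ = 2097152(d+1)²` of `B7ConclKExp.prop7Printed_K` and `min{c, 1}` with its `c`.  Proof: the global theorem at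
`π^*U₀`; the perturbed backgrounds `U′U₀` and `U′(π^*U₀)` agree on the box (`agreeOn_mul`), so `(A′, A) ↦ Q_k(U′·, ηA)(c)` and
`C_k(U′·, A)(c)` take the same values (`logCovIter_congr`, `linCovIter_congr`). [cite: Balaban1985Averaging, Proposition 7 p.43, Proposition 4 (134)–(135) pp.38–39, (158) p.42, p.24 (sentence after (43))] -/
theorem prop7Printed_K_local (L : ℕ) (hL : 2 ≤ L) (hG : AvgClosed d L G) :
    B7.Prop7Printed (concreteKExpLocal 𝔸 G (d := d) L) := by
  have hL1 : 1 ≤ L := le_trans (by norm_num) hL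
  obtain ⟨C₂, c, hC₂, hc, h⟩ := prop7Printed_K (𝔸 := 𝔸) (d := d) (G := G) L hL hG
  refine ⟨C₂, min c 1, hC₂, lt_min hc one_pos, ?_⟩
  rintro ⟨k, z, κ, y, μ⟩ α₀ α₁ hα₀ hα₀c hα₁ hα₁c U₀ hdev
  dsimp only [concreteKExpLocal] at U₀ hdev ⊢
  have hα1 : α₀ ≤ 1 := hα₀c.trans (min_le_right _ _)
  obtain ⟨hU₀'G, hdev', hag⟩ := clamped_regime hG.le_U1 hL1 k z κ hdev hα1
  set U₀' := clampCfg (loK L k z) (bondHiK L k z κ) U₀ with hU₀'def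
  obtain ⟨hjoint, hrem⟩ := h ⟨k, z, κ, y, μ⟩ α₀ α₁ hα₀ (hα₀c.trans (min_le_left _ _)) hα₁
    (hα₁c.trans (min_le_left _ _)) U₀' hdev'
  dsimp only [concreteKExp] at hjoint hrem
  -- the perturbed backgrounds `e^{B}U₀`, `e^{B}π^*U₀` agree on the box
  have hagp : ∀ B : Site d → Fin d → 𝔸,
      AgreeOn (loK L k z) (bondHiK L k z κ) (expCfg B * U₀) (expCfg B * U₀') := fun B =>
    agreeOn_mul (fun _ _ _ _ => rfl) hag
  refine ⟨fun S' S => ?_, fun A' A hA' hA => ?_⟩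
  · -- joint analyticity: the same function of `(A′, A)`
    have hfun : (fun p : (S' → 𝔸) × (S → 𝔸) =>
          logCovIter L (expCfg (((L : ℝ) ^ k)⁻¹ • insCfg S' p.1) * U₀) (((L : ℝ) ^ k)⁻¹ • insCfg S p.2) k z κ) =
        fun p : (S' → 𝔸) × (S → 𝔸) =>
          logCovIter L (expCfg (((L : ℝ) ^ k)⁻¹ • insCfg S' p.1) * U₀') (((L : ℝ) ^ k)⁻¹ • insCfg S p.2) k z κ :=
      funext fun p => logCovIter_congr L hL1 k z κ (hagp _) (fun _ _ _ _ => rfl)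
    rw [hfun]
    exact hjoint S' S
  · -- (135) at the background `U′U₀`, uniformly in `A′`
    rw [logCovIter_congr L hL1 k z κ (hagp _) (fun _ _ _ _ => rfl),
      linCovIter_congr L hL1 k z κ (hagp _) (fun _ _ _ _ => rfl)]
    exact hrem A' A hA' hA

/-- **The four `k`-fold conjuncts of `B7.Concl` WITH THE PRINTED LOCALITY for ONE family**: `p4 ∧ p5 ∧ p6 ∧ p7` for `concreteKExpLocal 𝔸 G L`,
`L ≥ 2`, `G` `AvgClosed`. [cite: Balaban1985Averaging, Proposition 4 pp.38–39, Proposition 5 p.42, Propositions 6–7 p.43] -/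
theorem p4567_K_local (L : ℕ) (hL : 2 ≤ L) (hG : AvgClosed d L G) :
    B7.Prop4Printed (concreteKExpLocal 𝔸 G (d := d) L) ∧ B7.Prop5Printed (concreteKExpLocal 𝔸 G (d := d) L) ∧
      B7.Prop6Printed (concreteKExpLocal 𝔸 G (d := d) L) ∧ B7.Prop7Printed (concreteKExpLocal 𝔸 G (d := d) L) :=
  ⟨prop4Printed_K_local L hL hG, prop5Printed_K_local L hL hG, prop6Printed_K_local L hL hG, prop7Printed_K_local L hL hG⟩

end Props

/-! ## §4 One step (Sect. C): Proposition 3 with the printed locality -/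

section OneStepLocal

variable (𝔸 : Type) [NormedRing 𝔸] [NormOneClass 𝔸] [NormedAlgebra ℂ 𝔸] [CompleteSpace 𝔸]

/-- **The concrete one-step family of B7 Sect. C on `ℤᵈ` WITH THE PRINTED LOCALITY for Proposition 3** (index `i = (q, κ)` = the `L`-bond
`c = ⟨q, q + Le_κ⟩` at which (121)–(123) are read): `Cfg` = `{|u| ≤ 1, |u⁻¹| ≤ 1}`-valued configurations; `plaqDev V = sup_{p ⊂ B(c₋) ∪ B(c₊)} |V(∂p) − 1|`
— (44) on `B(c₋) ∪ B(c₊) = [q, q + (L−1)𝟙 + Le_κ]` ONLY (p. 34 «an analytic function of the variables `A_b`, `b ⊂ B(c₋) ∪ B(c₊)`», p. 31 locality of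
(89)–(91)); `fldNorm`, `IsAnalyticQ`, `remC` as `B7ConclOneStep.concreteOneStepBD` (`sup_b‖A_b‖`, analyticity of `(A_b)_{b∈S} ↦ Q(V₀, A, c)` (121),
`‖C(V₀, A, c)‖` (122)); the Prop-1 field `avgDev` trivial — Prop. 1 with «(44) for `p ⊂ Δ(p′)`» is b07's `B7Prop1Local.concreteOneStepLocal` ∕
`prop1Printed_concrete_local` (the mirror convention: there the Prop-3 fields are trivial). [cite: Balaban1985Averaging, (44) p.24, (109) p.34, (121)–(122) p.36, p.34] -/
def concreteOneStepLocalC (L : ℕ) (i : Site d × Fin d) : B7.OneStep where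
  Cfg := {V : Site d → Fin d → 𝔸ˣ // ∀ x κ, V x κ ∈ U1 𝔸}
  Fld := BddFld d 𝔸
  plaqDev V := pdevOn i.1 (B7Prop1Local.bondHi L i.1 i.2) V.1
  avgDev _ := 0
  fldNorm A := ⨆ b : Site d × Fin d, ‖A.1 b.1 b.2‖
  IsAnalyticQ V₀ r := ∀ S : Finset (Site d × Fin d),
    AnalyticOnNhd ℂ (fun a : S → 𝔸 => Qcov L V₀.1 (insCfg S a) i.1 i.2) {a | ∀ s, ‖a s‖ < r}
  remC V₀ A := ‖Ccov L V₀.1 A.1 i.1 i.2‖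

variable {𝔸}

/-- **Proposition 3 (121)–(123) AS TYPED (`B7.Prop3Printed`) WITH THE PRINTED LOCALITY** for `concreteOneStepLocalC 𝔸 L`, every `d`, `L ≥ 1`,
`c₂ > 0`: witnesses those of `B7ConclOneStep.prop3Printed_BD` (`C₁ = 131072(d+1)²`, `c₃ = min{c₂, 1/(1024(d+1)(d+4)L²), 1/(128(d+1)L)}`).  For `V₀` with
(44) on `B(c₋) ∪ B(c₊)` only: the clamped extension `π^*V₀` satisfies (44) everywhere (`B7Prop1Local.pdev_clampCfg_le`), its block loops at `c` are
`1/64`-regular (`B7Eq123General.blockLoops_of_pdev`), so `A ↦ Q(π^*V₀, A, c)` is analytic on the polydisc of radius `α₁`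
(`B7Prop3GeneralAnalytic.prop3_general_analyticAt_of_le_c3`) and `‖C(π^*V₀, A, c)‖ ≤ C₁L²|A|²` (`B7Eq123General.norm_Ccov_le_of_pdev`); and
`Q(·, A, c)`, `C(·, A, c)` take the same values at `V₀` and `π^*V₀` (`B7Prop5GeneralLevels.Qcov_congr`, `Ccov_congr`). [cite: Balaban1985Averaging, Prop. 3 (121)–(123) p.36, (109) p.34, p.34 (locality sentence), p.31 (sentence after (91))] -/
theorem prop3Printed_localC (L : ℕ) (hL : 1 ≤ L) {c₂ : ℝ} (hc₂ : 0 < c₂) :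
    B7.Prop3Printed (L : ℝ) c₂ (concreteOneStepLocalC 𝔸 (d := d) L) := by
  refine ⟨131072 * ((d : ℝ) + 1) ^ 2,
    min c₂ (min (1 / (1024 * ((d : ℝ) + 1) * ((d : ℝ) + 4) * (L : ℝ) ^ 2)) (c3 d L)),
    by positivity, lt_min hc₂ (lt_min (by positivity) (c3_pos d hL)), min_le_left _ _, ?_⟩
  rintro ⟨q, κ⟩ α₀ α₁ hα₀ hα₀c hα₁ hα₁c ⟨V₀, hV₀⟩ hdev
  simp only [concreteOneStepLocalC] at hdev ⊢
  have hβmax : α₀ ≤ 1 / (1024 * ((d : ℝ) + 1) * ((d : ℝ) + 4) * (L : ℝ) ^ 2) :=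
    hα₀c.trans ((min_le_right _ _).trans (min_le_left _ _))
  have hα₁c3 : α₁ ≤ c3 d L := hα₁c.trans ((min_le_right _ _).trans (min_le_right _ _))
  -- the clamped extension of `V₀|B(c₋) ∪ B(c₊)`
  have hL' : (1 : ℤ) ≤ (L : ℤ) := by exact_mod_cast hL
  have hlohi : ∀ i, q i ≤ B7Prop1Local.bondHi L q κ i := fun i => by
    simp only [B7Prop1Local.bondHi]; split_ifs <;> omega
  set V₀' := clampCfg q (B7Prop1Local.bondHi L q κ) V₀ with hV₀'def
  have hV₀'1 : ∀ (x : Site d) (ν' : Fin d), V₀' x ν' ∈ U1 𝔸 := B7Prop1Local.clampCfg_mem hV₀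
  have hdev' : pdev V₀' < α₀ := (B7Prop1Local.pdev_clampCfg_le hlohi hV₀).trans_lt hdev
  have hag : AgreeOn q (B7Prop1Local.bondHi L q κ) V₀ V₀' := (clampCfg_agree V₀).symm
  obtain ⟨hreg, hα1⟩ := blockLoops_of_pdev hL hV₀'1 hα₀.le hdev' hβmax q κ
  refine ⟨fun S => ?_, fun A hA => ?_⟩
  · -- the analyticity clause on the polydisc `{∀ b, ‖a_b‖ < α₁}`: the same function at `V₀` and `π^*V₀`
    have hfun : (fun a' : S → 𝔸 => Qcov L V₀ (insCfg S a') q κ) = fun a' : S → 𝔸 => Qcov L V₀' (insCfg S a') q κ :=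
      funext fun a' => Qcov_congr L hL q κ hag (fun _ _ _ _ => rfl)
    rw [hfun]
    intro a ha
    have hna : ‖a‖ < α₁ := (pi_norm_lt_iff hα₁).2 ha
    have h := prop3_general_analyticAt_of_le_c3 (fun a' : S → 𝔸 => insCfg S a')
      (fun x κ' => analyticAt_insCfg S x κ' a) hL hV₀'1 (norm_nonneg a) (fun x κ' => norm_insCfg_le S a x κ')
      (hna.le.trans hα₁c3) q κ hα1 hreg
    simpa only [Qcov] using h
  · -- (123) at `c`
    have ha0 := fldNorm_nonneg A
    have hAa := norm_le_fldNorm A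
    rw [Ccov_congr L hL q κ hag (fun _ _ _ _ => rfl)]
    exact norm_Ccov_le_of_pdev hL hV₀'1 hα₀.le hdev' hβmax A.1 ha0 (fun x κ' => hAa x κ') (hA.le.trans hα₁c3) q κ

end OneStepLocal

/-! ## §5 Subgroups: the local family's hypothesis is antitone in `G` (any `G ≤ G′`, e.g. `SU(N) ≤ U(N)`; cf. `B7ConclSubgroup`) -/

section Mono

variable {𝔸 : Type} [NormedRing 𝔸] [NormOneClass 𝔸] [NormedAlgebra ℂ 𝔸] [CompleteSpace 𝔸] {G G' : Subgroup 𝔸ˣ}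

omit [NormOneClass 𝔸] [NormedAlgebra ℂ 𝔸] [CompleteSpace 𝔸] in
/-- **The box-local guard is antitone in `G`**: for `G ≤ G′`, `grpDefectOn G′ ≤ grpDefectOn G` (a configuration `G`-valued on the box is `G′`-valued there;
cf. `B7ConclSubgroup.grpDefect_anti`). [cite: Balaban1985Averaging, (52) p.26, p.18 («values in a Lie subgroup G of a unitary group U(N)»; bookkeeping)] -/
theorem grpDefectOn_anti (h : G ≤ G') (lo hi : Site d) (U : Site d → Fin d → 𝔸ˣ) :
    grpDefectOn G' lo hi U ≤ grpDefectOn G lo hi U := by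
  by_cases hU : ∀ (x : Site d) (κ : Fin d), InBox lo hi x → InBox lo hi (x + e κ) → U x κ ∈ G
  · rw [grpDefectOn_of_mem hU, grpDefectOn_of_mem fun x κ hx hxe => h (hU x κ hx hxe)]
  · rw [grpDefectOn_of_not_mem hU]
    exact grpDefectOn_le_one G' lo hi U

omit [NormOneClass 𝔸] in
/-- **The local small-field functional is antitone in the gauge group**: `plaqDevEta` of `concreteKExpLocal 𝔸 G′ L` is `≤` that of `concreteKExpLocal 𝔸 G L`
for `G ≤ G′` (cf. `B7ConclSubgroup.kExp_plaqDevEta_anti`). [cite: Balaban1985Averaging, (52) p.26 (bookkeeping)] -/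
theorem kExpLocal_plaqDevEta_anti (h : G ≤ G') (L : ℕ) (i : KIdx d) (U : Site d → Fin d → 𝔸ˣ) :
    (concreteKExpLocal 𝔸 G' (d := d) L i).plaqDevEta U ≤ (concreteKExpLocal 𝔸 G (d := d) L i).plaqDevEta U := by
  dsimp only [concreteKExpLocal]
  have hmono := grpDefectOn_anti (d := d) h (loK L i.k i.z) (bondHiK L i.k i.z i.κ) U
  linarith

omit [NormOneClass 𝔸] in
/-- **Propositions 4–7 with the printed locality transfer to subgroups** (same constants): the four typed statements for `concreteKExpLocal 𝔸 G′ L` imply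
them for `concreteKExpLocal 𝔸 G L`, `G ≤ G′` — the hypothesis at `G` implies it at `G′`, the conclusions do not read the gauge group
(cf. `B7ConclSubgroup.prop4Printed_K_of_le` …). [cite: Balaban1985Averaging, Proposition 4 pp.38–39, Proposition 5 p.42, Propositions 6–7 p.43, p.18] -/
theorem p4567_K_local_of_le (h : G ≤ G') (L : ℕ)
    (h4567 : B7.Prop4Printed (concreteKExpLocal 𝔸 G' (d := d) L) ∧ B7.Prop5Printed (concreteKExpLocal 𝔸 G' (d := d) L) ∧
      B7.Prop6Printed (concreteKExpLocal 𝔸 G' (d := d) L) ∧ B7.Prop7Printed (concreteKExpLocal 𝔸 G' (d := d) L)) :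
    B7.Prop4Printed (concreteKExpLocal 𝔸 G (d := d) L) ∧ B7.Prop5Printed (concreteKExpLocal 𝔸 G (d := d) L) ∧
      B7.Prop6Printed (concreteKExpLocal 𝔸 G (d := d) L) ∧ B7.Prop7Printed (concreteKExpLocal 𝔸 G (d := d) L) := by
  obtain ⟨⟨C₂, c₄, hC₂, hc₄, H4⟩, ⟨C₁', C₃, c₅, hC₁', hC₃, hc₅, H5⟩, ⟨O₁, c, hO₁, hc, H6⟩, ⟨C₂', c', hC₂', hc', H7⟩⟩ := h4567
  refine ⟨⟨C₂, c₄, hC₂, hc₄, fun i α₀ α₁ hα₀ hα₀c hα₁ hα₁c U₀ hdev =>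
      H4 i α₀ α₁ hα₀ hα₀c hα₁ hα₁c U₀ ((kExpLocal_plaqDevEta_anti h L i U₀).trans_lt hdev)⟩,
    ⟨C₁', C₃, c₅, hC₁', hC₃, hc₅, fun i α₀ α₁ hα₀ hα₀c hα₁ hα₁c U₀ hdev =>
      H5 i α₀ α₁ hα₀ hα₀c hα₁ hα₁c U₀ ((kExpLocal_plaqDevEta_anti h L i U₀).trans_lt hdev)⟩,
    ⟨O₁, c, hO₁, hc, fun i α₀ α₁ hα₀ hα₀c hα₁ hα₁c U₀ hdev =>
      H6 i α₀ α₁ hα₀ hα₀c hα₁ hα₁c U₀ ((kExpLocal_plaqDevEta_anti h L i U₀).trans_lt hdev)⟩,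
    ⟨C₂', c', hC₂', hc', fun i α₀ α₁ hα₀ hα₀c hα₁ hα₁c U₀ hdev =>
      H7 i α₀ α₁ hα₀ hα₀c hα₁ hα₁c U₀ ((kExpLocal_plaqDevEta_anti h L i U₀).trans_lt hdev)⟩⟩

end Mono

/-! ## §6 The paper's settings `G = U(N)` and `G = SU(N) ⊂ M_N(ℂ)` with the operator norm (19) -/

section Matrices

open scoped Matrix.Norms.L2Operator

/-- **Propositions 4–7 of B7 for `G = U(N)`, `N ≥ 1`, verbatim setting AND printed locality**: configurations on `ℤᵈ` with values in
`U(N) ⊂ M_N(ℂ)` on `Bᵏ(c₋) ∪ Bᵏ(c₊)`, `|·|` the operator norm (19), `L ≥ 2` (cf. `B7Prop1Local.prop2Printed_unitaryGroup_local`).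
[cite: Balaban1985Averaging, Propositions 4–7 pp.38–43, (19) p.21, p.18] -/
theorem p4567_unitaryGroup_local (N : ℕ) [NeZero N] (L : ℕ) (hL : 2 ≤ L) :
    B7.Prop4Printed (concreteKExpLocal (Matrix (Fin N) (Fin N) ℂ) (unitaryUnits (Matrix (Fin N) (Fin N) ℂ)) (d := d) L) ∧
    B7.Prop5Printed (concreteKExpLocal (Matrix (Fin N) (Fin N) ℂ) (unitaryUnits (Matrix (Fin N) (Fin N) ℂ)) (d := d) L) ∧
    B7.Prop6Printed (concreteKExpLocal (Matrix (Fin N) (Fin N) ℂ) (unitaryUnits (Matrix (Fin N) (Fin N) ℂ)) (d := d) L) ∧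
    B7.Prop7Printed (concreteKExpLocal (Matrix (Fin N) (Fin N) ℂ) (unitaryUnits (Matrix (Fin N) (Fin N) ℂ)) (d := d) L) := by
  letI : CStarAlgebra (Matrix (Fin N) (Fin N) ℂ) := {}
  exact p4567_K_local L hL (avgClosed_unitaryUnits d L)

/-- **Propositions 4–7 of B7 for `G = SU(N)`, EVERY `N ≥ 1`, verbatim setting AND printed locality** — at `SU(N) ≤ U(N)`
(`B7Prop2SpecialUnitary.specialUnitaryUnits_le_unitaryUnits`) by the antitone transfer `p4567_K_local_of_le` (the gauge group enters the typed statements on the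
HYPOTHESIS side only; cf. `B7ConclSubgroup.concl_specialUnitary` and its §4 caveat: the `SU(N)`-valuedness of the averages themselves is no part of the leaf).
[cite: Balaban1985Averaging, Propositions 4–7 pp.38–43, pp.18–21 (17)–(19) (setting; kernel version, SU(N), every N)] -/
theorem p4567_specialUnitary_local (N : ℕ) [NeZero N] (L : ℕ) (hL : 2 ≤ L) :
    B7.Prop4Printed (concreteKExpLocal (Matrix (Fin N) (Fin N) ℂ) (B7Prop2SpecialUnitary.specialUnitaryUnits (Fin N)) (d := d) L) ∧
    B7.Prop5Printed (concreteKExpLocal (Matrix (Fin N) (Fin N) ℂ) (B7Prop2SpecialUnitary.specialUnitaryUnits (Fin N)) (d := d) L) ∧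
    B7.Prop6Printed (concreteKExpLocal (Matrix (Fin N) (Fin N) ℂ) (B7Prop2SpecialUnitary.specialUnitaryUnits (Fin N)) (d := d) L) ∧
    B7.Prop7Printed (concreteKExpLocal (Matrix (Fin N) (Fin N) ℂ) (B7Prop2SpecialUnitary.specialUnitaryUnits (Fin N)) (d := d) L) :=
  p4567_K_local_of_le B7Prop2SpecialUnitary.specialUnitaryUnits_le_unitaryUnits L (p4567_unitaryGroup_local N L hL)

end Matrices

end Literature.MathematicalPhysics.QuantumFieldTheory.Balaban1983to89.B7Prop3to7Local

end
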